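import Mathlib
import Summits.QuantumFields.YangMills.Theorems.CoarseStiffnessTailCappedCoarseStiffnessLAveragedJointPeierls
import Literature.MathematicalPhysics.QuantumFieldTheory.Balaban1983to89.T3ThresholdSmallness

/-!
# Route `CoarseStiffnessTail` — THE EDGE STUB OF CRUX `CappedCoarseStiffnessL` HOLDS AT EVERY BOUNDED DEPTH: the uniform large-field count
# of the block-AVERAGED plaquettes `Ū^j`, `j ≤ j₀`, with constants uniform in the cut-off `K`, the volume exponent `m` and the coupling
# `γ ≤ γ₁(j₀)` (lead's certificate, seat `ym-line-cst-p1` g13; helper on crux stmt-QuantumFields-25301, file 3 of 3)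

THE THEOREM (`uniformLargeFieldCount_boundedDepth`).  For every `L`, every profile `(b₀, p₀)` with `0 < b₀`, `2 < p₀` (only `1 ≤ p₀` is used) and
every `j₀` there are `c₀ > 0`, `C₀ = log 2`, `γ₁ ∈ (0, 1]` such that for EVERY three-torus family `F` with `F.L = L`, every `0 < γ ≤ γ₁`, every
cut-off `K` and every depth `j ≤ min(K, j₀)`:

  `∫ exp(c₀ · p(g_{K−j})² · N_j(U)) dGibbs_K ≤ exp(log 2 · #Plaq_j)`,   `N_j(U) = #{a ∈ Plaq_j : θ(K−j) ≤ |Ū^j(∂a) − 1|}`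

— the registered EDGE stub `stub_uniformLargeFieldCountPos` of skeleton v5 (`Cruxes/CappedCoarseStiffnessL/Lines/birth.lean`) with its depth
variable restricted to `j ≤ j₀`, in the stub's own letters (§3).  The bare case `j₀ = 0` is g9's `bare_uniformLargeFieldCount` (p645503, `c₀ = 1/24`);
here `c₀(j₀) = min_{j ≤ j₀} L^j/(144(2j+1)³C₁^{2j})`, `C₁ = 151L²`.

PROOF.  §1 arithmetic of Bałaban's scaled family: `β_K = L^j β_{K−j}`, `β_Kθ(K−j)² = L^j p(g_{K−j})²`, `log √β_K = log g_{K−j}⁻¹ + (j/2)log L`, and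
«the profile beats the entropy» (`sq_pFun_ge'`: `8A + 72Bx ≤ p(g)²` once `x = log g⁻¹ ≥ (8A + 72B)/b₀²`).  §2 ★★ `averaged_jointPeierls`: file 2's
raw joint Peierls bound for level-`j` families (`(3(2j+1)³L^{3j})^{#S}·(min δ 1)^{#S/(9(2j+1)³)}`, `δ = 2e^{24}c⁻³(√β_K)^9 e^{−β_Kθ²/(4C₁^{2j})}`)
becomes `exp(−c_j·p(g_{K−j})²·#S)`, `c_j = L^j/(144(2j+1)³C₁^{2j})`, once `γ ≤ γ₁(j) = min(e^{−2X_j}, γ_θ)` (`γ_θ`: the thresholds `θ(i)` are below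
the guard of the local Prop. 1, `T3ThresholdSmallness.exists_forall_θBal_le`).  §3: «joint Peierls for all subfamilies ⇒ count exponential moment»
(`CoarseStiffnessTailLargeFieldCount.integral_exp_count_le_of_jointPeierls`, p635820, `B = 1`) at each depth, and the minimum of the constants over
`j ≤ j₀` (`CoarseStiffnessTailBareUniformCount.integral_exp_count_mono`).

READING (line card §g13; for planners / director / a future siege — no claim about Bałaban's estimates).
* FIRST KERNEL STATEMENT OF THIS CHAIN ABOUT THE AVERAGED LEVELS OF THE INTERACTING LAW.  Every earlier certificate at `j ≥ 1` was either a
  reformulation of the crux (p628112, p630749, p641555), a consequence of it (p625791, p633005, p636229, p639501), or the LINEARISED theory (p649808).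
  This file proves the EDGE conjunct itself, for the Wilson law of `SU(2)` on all of Bałaban's tori, at every fixed depth — K-, m- and γ-uniformly.
* WHERE THE CONTENT SITS, NOW SHARPLY.  The rate obtained is `p(g_{K−j})²·L^j/(144(2j+1)³C₁^{2j})`: GEOMETRICALLY DECAYING IN `j`, because the
  transfer «large averaged plaquette ⇒ large fine plaquette» is done in MAX currency (threshold `÷ 151L²` per level) while the Gaussian gain of the
  fine law is only `L^j`.  Any max-currency transfer has `C₁ ≥ L²` (the axial `L × L` Stokes square alone), hence decay `≤ (1/L³)^j`: bounded depth is
  the honest ceiling of single-scale arguments.  The registered stub asks for ONE `c₀` at ALL depths `1 ≤ j ≤ K` — its located content is exactly the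
  NON-DECAY of the joint Peierls rate in the depth, i.e. that block averaging CONTRACTS fluctuations at the rate the effective coupling predicts
  ([Balaban1985UV3] (71) p.273: `exp(−¼p(g_j)²)` per large plaquette at EVERY `j` — the multi-scale renormalisation-group content, not in print as an
  integrated bound).  Consistent with JOB A / JOB F (instrument, GUIDANCE): nothing at `K ≤ 5` distinguishes decay from non-decay.

HONEST SCOPE.  Elementary and unconditional; composed from tree theorems by name.  The EDGE stub (all depths), the BULK stub, the crux 25301 and
`HistoryTailL` 19936 stay OPEN; `YM3TorusSU2` (rung R3, a RECORD rung, not the Clay statement) is NOT proved; the Yang–Mills mass gap is NOT touched.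

References: T. Bałaban, CMP **102** (1985) 255–275 [Balaban1985UV3] ((1)–(3) p.256, (7) p.257, (71) p.273); CMP **98** (1985) 17–51
[Balaban1985Averaging] (Prop. 1 (51) p.26); J. Fröhlich, R. Israel, E. Lieb, B. Simon, CMP **62** (1978) 1–34 [FrohlichIsraelLiebSimon1978] (Thm 4.1).
-/

noncomputable section

namespace Summit.QuantumFields.YangMills.Theorems.CoarseStiffnessTailEdgeBoundedDepth

open MeasureTheory Finset
open Literature.MathematicalPhysics.QuantumFieldTheory
open Literature.MathematicalPhysics.QuantumFieldTheory.Balaban1983to89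
open Literature.MathematicalPhysics.QuantumFieldTheory.Balaban1983to89.BlockAveraging (avgFun blockAvg blockAvg_avg)
open Literature.MathematicalPhysics.QuantumFieldTheory.Balaban1983to89.ExpMeanLog (expMeanLogSU deltaSU deltaSU_pos)
open Literature.MathematicalPhysics.QuantumFieldTheory.Balaban1983to89.T3ContinuumYM3Torus
open Literature.MathematicalPhysics.QuantumFieldTheory.Balaban1983to89.T3UnitScaleTilt
open Literature.MathematicalPhysics.QuantumFieldTheory.Balaban1983to89.T3UnitLawDensityEML
open Literature.MathematicalPhysics.QuantumFieldTheory.Balaban1983to89.T3FinestHeightTail (beta_mul_θBal_sq)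
open Literature.MathematicalPhysics.QuantumFieldTheory.Balaban1983to89.T3MinimiserStabilityReduction (θBal_pos)
open Literature.MathematicalPhysics.QuantumFieldTheory.Balaban1983to89.T3ThresholdSmallness (exists_forall_θBal_le)
open Summit.QuantumFields.YangMills.Theorems.CoarseStiffnessTailIteratedProp1 (one_le_C₁)
open Summit.QuantumFields.YangMills.Theorems.CoarseStiffnessTailAveragedJointPeierls (gibbsK_real_forall_avg_ge_le)
open Summit.QuantumFields.YangMills.Theorems.CoarseStiffnessTailLargeFieldCount (integral_exp_count_le_of_jointPeierls)
open Summit.QuantumFields.YangMills.Theorems.CoarseStiffnessTailBareUniformCount (coupling_facts pFun_nonneg integral_exp_count_mono)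

/-! ## §1 Arithmetic of the scaled family and of the profile -/

section Arithmetic

/-- **THE PROFILE BEATS THE ENTROPY** (two-parameter form of `CoarseStiffnessTailBareUniformCount.sq_pFun_ge`): for `0 < b₀`, `1 ≤ p₀`, `0 ≤ A`,
`0 ≤ B` and `x = log g⁻¹ ≥ (8A + 72B)/b₀²`: `8A + 72B·x ≤ p(g)² = b₀²(1 + x)^{2p₀}`. [folklore] -/
theorem sq_pFun_ge' {b₀ p₀ A B g : ℝ} (hb₀ : 0 < b₀) (hp₀ : 1 ≤ p₀) (hA : 0 ≤ A) (hB : 0 ≤ B)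
    (hx : (8 * A + 72 * B) / b₀ ^ 2 ≤ Real.log g⁻¹) :
    8 * A + 72 * B * Real.log g⁻¹ ≤ B10.pFun b₀ p₀ g ^ 2 := by
  set x : ℝ := Real.log g⁻¹ with hxdef
  have hb2 : 0 < b₀ ^ 2 := pow_pos hb₀ 2
  have hx0 : 0 ≤ x := le_trans (div_nonneg (by positivity) hb2.le) hx
  have hy1 : 1 ≤ 1 + x := by linarith
  have hy0 : 0 ≤ 1 + x := by linarith
  have hrpow : 1 + x ≤ (1 + x) ^ p₀ := by
    calc 1 + x = (1 + x) ^ (1 : ℝ) := (Real.rpow_one _).symm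
      _ ≤ (1 + x) ^ p₀ := Real.rpow_le_rpow_of_exponent_le hy1 hp₀
  have hpf : B10.pFun b₀ p₀ g = b₀ * (1 + x) ^ p₀ := rfl
  rw [hpf, mul_pow]
  have hsq : (1 + x) ^ 2 ≤ ((1 + x) ^ p₀) ^ 2 := pow_le_pow_left₀ hy0 hrpow 2
  have hx' : 8 * A + 72 * B ≤ b₀ ^ 2 * x := by
    have := mul_le_mul_of_nonneg_left hx hb2.le
    rwa [mul_div_cancel₀ _ hb2.ne'] at this
  calc 8 * A + 72 * B * x ≤ (8 * A + 72 * B) * (1 + x) := by nlinarith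
    _ ≤ b₀ ^ 2 * x * (1 + x) := mul_le_mul_of_nonneg_right hx' hy0
    _ ≤ b₀ ^ 2 * (1 + x) ^ 2 := by nlinarith
    _ ≤ b₀ ^ 2 * ((1 + x) ^ p₀) ^ 2 := mul_le_mul_of_nonneg_left hsq hb2.le

variable (F : T3Family)

/-- **SCALING OF THE FAMILY**: `β_K = L^j·β_{K−j}` for `j ≤ K` (`β_i = (γL^{−i})⁻¹`). [cite: Balaban1985UV3, (1)-(3) p.256] -/
theorem beta_eq_pow_mul {γ : ℝ} {K j : ℕ} (hjK : j ≤ K) :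
    (γ * ((F.L : ℝ)⁻¹) ^ K)⁻¹ = (F.L : ℝ) ^ j * (γ * ((F.L : ℝ)⁻¹) ^ (K - j))⁻¹ := by
  have hK : K = (K - j) + j := (Nat.sub_add_cancel hjK).symm
  have h1 : (((F.L : ℝ)⁻¹) ^ j)⁻¹ = (F.L : ℝ) ^ j := by rw [inv_pow, inv_inv]
  conv_lhs => rw [hK, pow_add]
  rw [← mul_assoc, mul_inv, h1, mul_comm]

/-- `β_K·θ(K−j)² = L^j·p(g_{K−j})²` (`β_{K−j}θ(K−j)² = p(g_{K−j})²`, tree `beta_mul_θBal_sq`, and §1 scaling). [cite: Balaban1985UV3, (3) p.256 and (7) p.257] -/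
theorem beta_mul_θBal_sq_depth {γ : ℝ} (hγ : 0 < γ) (b₀ p₀ : ℝ) {K j : ℕ} (hjK : j ≤ K) :
    (γ * ((F.L : ℝ)⁻¹) ^ K)⁻¹ * θBal F.L γ b₀ p₀ (K - j) ^ 2 =
      (F.L : ℝ) ^ j * B10.pFun b₀ p₀ (Real.sqrt (γ * ((F.L : ℝ)⁻¹) ^ (K - j))) ^ 2 := by
  have h := beta_mul_θBal_sq F hγ b₀ p₀ (K - j)
  have hβ : (F.scheme ℰp γ).β (K - j) = (γ * ((F.L : ℝ)⁻¹) ^ (K - j))⁻¹ := rfl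
  rw [hβ] at h
  rw [beta_eq_pow_mul F hjK, mul_assoc, h]

/-- `log √β_K = log g_{K−j}⁻¹ + (j/2)·log L` (`g_i = √(γL^{−i})`). [cite: Balaban1985UV3, (3) p.256] -/
theorem log_sqrt_beta {γ : ℝ} (hγ : 0 < γ) {K j : ℕ} (hjK : j ≤ K) :
    Real.log (Real.sqrt ((γ * ((F.L : ℝ)⁻¹) ^ K)⁻¹)) =
      Real.log (Real.sqrt (γ * ((F.L : ℝ)⁻¹) ^ (K - j)))⁻¹ + (j : ℝ) / 2 * Real.log (F.L : ℝ) := by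
  have hL0 : (0 : ℝ) < F.L := by exact_mod_cast lt_trans zero_lt_one F.hL.2
  have hx0 : 0 < γ * ((F.L : ℝ)⁻¹) ^ (K - j) := mul_pos hγ (pow_pos (inv_pos.mpr hL0) _)
  rw [beta_eq_pow_mul F hjK, Real.log_sqrt (by positivity), Real.log_mul (by positivity) (inv_pos.mpr hx0).ne',
    Real.log_pow, ← Real.sqrt_inv, Real.log_sqrt (inv_pos.mpr hx0).le]
  ring

end Arithmetic

/-! ## §2 The joint Peierls bound for averaged families at depth `j`, rate `c_j·p(g_{K−j})²` -/

section Peierls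

/-- Exponential bookkeeping: if `D = e^A`, `s^9 = e^{9y}`, `E = p²/(4Q)` and `A + 9y ≤ p²/(8Q)`, then `D·s^9·e^{−E} ≤ e^{−p²/(8Q)}`. [folklore] -/
theorem delta_le_exp {D s E A y p Q : ℝ} (hD : D = Real.exp A) (hs : s ^ 9 = Real.exp (9 * y)) (hE : E = p ^ 2 / (4 * Q))
    (hQ : 0 < Q) (hent : A + 9 * y ≤ p ^ 2 / (8 * Q)) :
    D * s ^ 9 * Real.exp (-E) ≤ Real.exp (-(p ^ 2 / (8 * Q))) := by
  rw [hD, hs, hE, ← Real.exp_add, ← Real.exp_add, Real.exp_le_exp]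
  have : p ^ 2 / (4 * Q) = 2 * (p ^ 2 / (8 * Q)) := by field_simp; ring
  rw [this]; linarith

/-- Exponential bookkeeping: `Rm^n · (min δ 1)^{n/(3M)} ≤ exp(−p²n/(48MQ))` once `δ ≤ e^{−p²/(8Q)}` and `log Rm ≤ p²/(48MQ)`
(`Rm, M, Q > 0`, `δ ≥ 0`). [folklore] -/
theorem entropy_rate_bound {δ p Q Mr Rm : ℝ} (n : ℕ) (hδ0 : 0 ≤ δ) (hRm0 : 0 < Rm) (hMr0 : 0 < Mr) (hQ0 : 0 < Q)
    (hδ : δ ≤ Real.exp (-(p ^ 2 / (8 * Q)))) (hRm : Real.log Rm ≤ p ^ 2 / (48 * Mr * Q)) :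
    Rm ^ n * (min δ 1) ^ ((n : ℝ) / (3 * Mr)) ≤ Real.exp (-(1 / (48 * Mr * Q) * p ^ 2) * (n : ℝ)) := by
  have hmin0 : 0 ≤ min δ 1 := le_min hδ0 zero_le_one
  have hmin : min δ 1 ≤ Real.exp (-(p ^ 2 / (8 * Q))) := (min_le_left _ _).trans hδ
  have hs0 : 0 ≤ (n : ℝ) / (3 * Mr) := by positivity
  have hpow : (min δ 1) ^ ((n : ℝ) / (3 * Mr)) ≤ Real.exp (-(p ^ 2 / (8 * Q)) * ((n : ℝ) / (3 * Mr))) := by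
    rw [Real.exp_mul]
    exact Real.rpow_le_rpow hmin0 hmin hs0
  have hRmpow : Rm ^ n = Real.exp ((n : ℝ) * Real.log Rm) := by
    rw [← Real.exp_log hRm0, ← Real.exp_nat_mul, Real.log_exp]
  have hRm' : Real.log Rm * (48 * Mr * Q) ≤ p ^ 2 := (le_div_iff₀ (by positivity)).mp hRm
  calc Rm ^ n * (min δ 1) ^ ((n : ℝ) / (3 * Mr))
      ≤ Real.exp ((n : ℝ) * Real.log Rm) * Real.exp (-(p ^ 2 / (8 * Q)) * ((n : ℝ) / (3 * Mr))) := by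
        rw [hRmpow]; exact mul_le_mul_of_nonneg_left hpow (Real.exp_pos _).le
    _ = Real.exp ((n : ℝ) * (Real.log Rm - p ^ 2 / (24 * Mr * Q))) := by
        rw [← Real.exp_add]; congr 1; field_simp; ring
    _ ≤ Real.exp (-(1 / (48 * Mr * Q) * p ^ 2) * (n : ℝ)) := by
        rw [Real.exp_le_exp]
        have hcard : (0 : ℝ) ≤ n := Nat.cast_nonneg _
        have hkey : Real.log Rm - p ^ 2 / (24 * Mr * Q) ≤ -(1 / (48 * Mr * Q) * p ^ 2) := by
          rw [div_eq_mul_one_div (p ^ 2) (24 * Mr * Q), sub_le_iff_le_add]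
          have h48 : Real.log Rm ≤ p ^ 2 * (1 / (48 * Mr * Q)) := by
            rw [← div_eq_mul_one_div]; exact hRm
          have hsplit : p ^ 2 * (1 / (24 * Mr * Q)) = 2 * (p ^ 2 * (1 / (48 * Mr * Q))) := by
            field_simp; ring
          rw [hsplit]; linarith
        calc (n : ℝ) * (Real.log Rm - p ^ 2 / (24 * Mr * Q)) ≤ (n : ℝ) * (-(1 / (48 * Mr * Q) * p ^ 2)) :=
            mul_le_mul_of_nonneg_left hkey hcard
          _ = -(1 / (48 * Mr * Q) * p ^ 2) * (n : ℝ) := by ring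

/-- The one-step constant dominates the block size: `L ≤ C₁ = L² + 6(5L)²` and `1 ≤ Q_j = C₁^{2j}/L^j` (`1 ≤ L`). [folklore] -/
theorem one_le_Q {L : ℕ} (hL : 1 ≤ L) (j : ℕ) :
    (L : ℝ) ≤ (L : ℝ) ^ 2 + 6 * (((3 + 2) * L : ℕ) : ℝ) ^ 2 ∧
      1 ≤ ((L : ℝ) ^ 2 + 6 * (((3 + 2) * L : ℕ) : ℝ) ^ 2) ^ (2 * j) / (L : ℝ) ^ j := by
  have hL1 : (1 : ℝ) ≤ L := by exact_mod_cast hL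
  have hL0 : (0 : ℝ) < L := one_pos.trans_le hL1
  have hC₁L : (L : ℝ) ≤ (L : ℝ) ^ 2 + 6 * (((3 + 2) * L : ℕ) : ℝ) ^ 2 := by
    nlinarith [sq_nonneg (((3 + 2) * L : ℕ) : ℝ)]
  have hC₁1 : (1 : ℝ) ≤ (L : ℝ) ^ 2 + 6 * (((3 + 2) * L : ℕ) : ℝ) ^ 2 := hL1.trans hC₁L
  refine ⟨hC₁L, ?_⟩
  rw [one_le_div (pow_pos hL0 j), pow_mul]
  exact pow_le_pow_left₀ hL0.le (hC₁L.trans (le_self_pow₀ hC₁1 two_ne_zero)) j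

/-- **JOINT PEIERLS FOR LEVEL-`j` AVERAGED PLAQUETTES AT THE THRESHOLD `θ(K−j)`, UNIFORMLY IN THE VOLUME, THE CUT-OFF AND `γ ≤ γ₁(j)`.**
For every `L`, `j`, `0 < b₀`, `1 ≤ p₀` there are `c₀ > 0` (explicitly `L^j/(144(2j+1)³C₁^{2j})`, `C₁ = L² + 6(5L)²`) and `γ₁ ∈ (0, 1]` such that
for every family `F` with `F.L = L`, every `0 < γ ≤ γ₁`, every cut-off `K ≥ j` and EVERY finite family `S` of plaquettes of `T^{(j)}`:
`Gibbs_K{∀ a ∈ S, θ(K−j) ≤ |Ū^j(∂a) − 1|} ≤ exp(−c₀·p(g_{K−j})²·#S)`. [cite: Balaban1985UV3, (71) p.273; Balaban1985Averaging, Prop. 1 (51) p.26; FrohlichIsraelLiebSimon1978, Thm 4.1] -/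
theorem averaged_jointPeierls (L j : ℕ) {b₀ p₀ : ℝ} (hb₀ : 0 < b₀) (hp₀ : 1 ≤ p₀) :
    ∃ c₀ γ₁ : ℝ, 0 < c₀ ∧ 0 < γ₁ ∧ γ₁ ≤ 1 ∧ ∀ (F : T3Family) (γ : ℝ), F.L = L → 0 < γ → γ ≤ γ₁ →
      ∀ (K : ℕ), j ≤ K → ∀ S : Finset (Plaq (F.P K) j),
        (gibbsK F ℰp γ K).real {U | ∀ a ∈ S, θBal F.L γ b₀ p₀ (K - j) ≤ GaugeGroup.dist1 (GaugeField.plaqHol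
            (Averaging.iter (fun i => blockAvg (P := F.P K) (j := i) ℰp) j U) a)} ≤
          Real.exp (-(c₀ * B10.pFun b₀ p₀ (Real.sqrt (γ * ((F.L : ℝ)⁻¹) ^ (K - j))) ^ 2) * (S.card : ℝ)) := by
  -- degenerate block sizes carry no family
  by_cases hL : 1 < L
  swap
  · refine ⟨1, 1, one_pos, one_pos, le_rfl, fun F γ hFL => ?_⟩
    exact absurd (hFL ▸ F.hL.2) hL
  obtain ⟨c, hc, hc1, hraw⟩ := gibbsK_real_forall_avg_ge_le
  -- constants
  have hL0 : (0 : ℝ) < L := by exact_mod_cast lt_trans zero_lt_one hL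
  have hL1 : (1 : ℝ) ≤ L := by exact_mod_cast hL.le
  obtain ⟨C₁, hC₁⟩ : ∃ C₁ : ℝ, C₁ = (L : ℝ) ^ 2 + 6 * (((3 + 2) * L : ℕ) : ℝ) ^ 2 := ⟨_, rfl⟩
  obtain ⟨hC₁L, hQ1⟩ := one_le_Q hL.le j
  rw [← hC₁] at hC₁L hQ1
  have hC₁0 : 0 < C₁ := hL0.trans_le hC₁L
  obtain ⟨Q, hQ⟩ : ∃ Q : ℝ, Q = C₁ ^ (2 * j) / (L : ℝ) ^ j := ⟨_, rfl⟩
  rw [← hQ] at hQ1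
  have hQ0 : 0 < Q := one_pos.trans_le hQ1
  obtain ⟨Mr, hMr⟩ : ∃ Mr : ℝ, Mr = ((3 * (2 * j + 1) ^ 3 : ℕ) : ℝ) := ⟨_, rfl⟩
  have hMr1 : 1 ≤ Mr := by rw [hMr]; exact_mod_cast Nat.one_le_iff_ne_zero.mpr (by positivity)
  have hMr0 : 0 < Mr := one_pos.trans_le hMr1
  obtain ⟨Rm, hRm⟩ : ∃ Rm : ℝ, Rm = ((3 * ((2 * j + 1) ^ 3 * L ^ (3 * j)) : ℕ) : ℝ) := ⟨_, rfl⟩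
  have hRm1 : 1 ≤ Rm := by
    rw [hRm]; exact_mod_cast Nat.one_le_iff_ne_zero.mpr (by positivity)
  have hRm0 : 0 < Rm := one_pos.trans_le hRm1
  have hlogRm : 0 ≤ Real.log Rm := Real.log_nonneg hRm1
  obtain ⟨D, hD⟩ : ∃ D : ℝ, D = 2 * Real.exp 24 * (c ^ 3)⁻¹ := ⟨_, rfl⟩
  have hD1 : 1 ≤ D := by
    have h1 : (1 : ℝ) ≤ (c ^ 3)⁻¹ := (one_le_inv₀ (pow_pos hc 3)).mpr (pow_le_one₀ hc.le hc1)
    have h2 : (1 : ℝ) ≤ Real.exp 24 := Real.one_le_exp (by norm_num)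
    rw [hD]; nlinarith
  have hD0 : 0 < D := one_pos.trans_le hD1
  obtain ⟨A, hA⟩ : ∃ A : ℝ, A = Real.log D := ⟨_, rfl⟩
  have hA0 : 0 ≤ A := by rw [hA]; exact Real.log_nonneg hD1
  have hlogL : 0 ≤ Real.log (L : ℝ) := Real.log_nonneg hL1
  -- the entropy budget `A' = Q(A + (9/2) j log L + 6 Mr log Rm)`, `B = Q`, and the threshold `X`
  obtain ⟨A', hA'⟩ : ∃ A' : ℝ, A' = Q * (A + 9 / 2 * (j : ℝ) * Real.log (L : ℝ) + 6 * Mr * Real.log Rm) := ⟨_, rfl⟩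
  have hA'0 : 0 ≤ A' := by rw [hA']; positivity
  obtain ⟨X, hX⟩ : ∃ X : ℝ, X = (8 * A' + 72 * Q) / b₀ ^ 2 := ⟨_, rfl⟩
  have hX0 : 0 ≤ X := by rw [hX]; exact div_nonneg (by positivity) (pow_pos hb₀ 2).le
  -- the guard of the local Prop. 1 on the thresholds
  have h25 : (0 : ℝ) < (((3 + 2) * L : ℕ) : ℝ) ^ 2 := by positivity
  obtain ⟨γθ, hγθ, hθle⟩ := exists_forall_θBal_le (L := L) hL.le b₀ p₀
    (ε := 2 * deltaSU (Fin 2) / (((3 + 2) * L : ℕ) : ℝ) ^ 2) (div_pos (mul_pos two_pos deltaSU_pos) h25)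
  -- the constants
  refine ⟨1 / (48 * Mr * Q), min (Real.exp (-(2 * X))) (min γθ 1), by positivity,
    lt_min (Real.exp_pos _) (lt_min hγθ one_pos), (min_le_right _ _).trans (min_le_right _ _), ?_⟩
  intro F γ hFL hγ hγ1 K hjK S
  have hγ1' : γ ≤ 1 := hγ1.trans ((min_le_right _ _).trans (min_le_right _ _))
  have hγθ' : γ ≤ γθ := hγ1.trans ((min_le_right _ _).trans (min_le_left _ _))
  have hγX : γ ≤ Real.exp (-(2 * X)) := hγ1.trans (min_le_left _ _)
  subst hFL
  obtain ⟨-, -, hβ1⟩ := coupling_facts F hγ hγ1' K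
  obtain ⟨hg2pos, hg2le, -⟩ := coupling_facts F hγ hγ1' (K - j)
  have hβeq : (F.scheme ℰp γ).β K = (γ * ((F.L : ℝ)⁻¹) ^ K)⁻¹ := rfl
  have hgpos : 0 < Real.sqrt (γ * ((F.L : ℝ)⁻¹) ^ (K - j)) := Real.sqrt_pos.mpr hg2pos
  have hθ0 : 0 ≤ θBal F.L γ b₀ p₀ (K - j) := (θBal_pos hL.le hγ hγ1' hb₀ p₀ (K - j)).le
  -- the guard
  have hguard : ((((F.P K).d + 2) * (F.P K).L : ℕ) : ℝ) ^ 2 / 4 * θBal F.L γ b₀ p₀ (K - j) < deltaSU (Fin 2) := by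
    show (((3 + 2) * F.L : ℕ) : ℝ) ^ 2 / 4 * θBal F.L γ b₀ p₀ (K - j) < deltaSU (Fin 2)
    have hθε := hθle γ hγ hγθ' (K - j)
    calc (((3 + 2) * F.L : ℕ) : ℝ) ^ 2 / 4 * θBal F.L γ b₀ p₀ (K - j) ≤ (((3 + 2) * F.L : ℕ) : ℝ) ^ 2 / 4 *
          (2 * deltaSU (Fin 2) / (((3 + 2) * F.L : ℕ) : ℝ) ^ 2) := mul_le_mul_of_nonneg_left hθε (by positivity)
      _ = deltaSU (Fin 2) / 2 := by field_simp; ring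
      _ < deltaSU (Fin 2) := by linarith [deltaSU_pos (n := Fin 2)]
  -- the raw bound of file 2
  have hS := hraw F γ hγ.le K (hβeq ▸ hβ1) j hjK (θBal F.L γ b₀ p₀ (K - j)) hθ0 hguard S
  have hC₁' : ((F.P K).L : ℝ) ^ 2 + 6 * ((((F.P K).d + 2) * (F.P K).L : ℕ) : ℝ) ^ 2 = C₁ := by rw [hC₁]; rfl
  have hRm' : ((3 * ((2 * j + 1) ^ 3 * (F.P K).L ^ (3 * j)) : ℕ) : ℝ) = Rm := by rw [hRm]; rfl
  have hMr' : ((3 * (2 * j + 1) ^ 3 : ℕ) : ℝ) = Mr := by rw [hMr]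
  rw [hC₁', hRm', hMr', hβeq, ← hD] at hS
  refine hS.trans ?_
  -- `x = log g⁻¹ ≥ X`, hence the profile beats the entropy
  have hlogg : X ≤ Real.log (Real.sqrt (γ * ((F.L : ℝ)⁻¹) ^ (K - j)))⁻¹ := by
    have hg2 : Real.sqrt (γ * ((F.L : ℝ)⁻¹) ^ (K - j)) ^ 2 ≤ Real.exp (-(2 * X)) := by
      rw [Real.sq_sqrt hg2pos.le]; exact hg2le.trans hγX
    have hlog2 : Real.log (Real.sqrt (γ * ((F.L : ℝ)⁻¹) ^ (K - j)) ^ 2) ≤ -(2 * X) := by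
      rw [← Real.log_exp (-(2 * X))]; exact Real.log_le_log (pow_pos hgpos 2) hg2
    rw [Real.log_pow] at hlog2
    rw [Real.log_inv]
    push_cast at hlog2
    linarith
  have hent : 8 * A' + 72 * Q * Real.log (Real.sqrt (γ * ((F.L : ℝ)⁻¹) ^ (K - j)))⁻¹ ≤
      B10.pFun b₀ p₀ (Real.sqrt (γ * ((F.L : ℝ)⁻¹) ^ (K - j))) ^ 2 :=
    sq_pFun_ge' hb₀ hp₀ hA'0 hQ0.le (by rw [← hX]; exact hlogg)
  -- abbreviate
  generalize hx : Real.log (Real.sqrt (γ * ((F.L : ℝ)⁻¹) ^ (K - j)))⁻¹ = x at hent hlogg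
  generalize hp : B10.pFun b₀ p₀ (Real.sqrt (γ * ((F.L : ℝ)⁻¹) ^ (K - j))) = p at hent
  have hx0 : 0 ≤ x := hX0.trans hlogg
  have h8A' : 8 * A' = 8 * Q * (A + 9 / 2 * (j : ℝ) * Real.log (F.L : ℝ)) + 48 * Q * Mr * Real.log Rm := by
    rw [hA']; ring
  have hnn1 : 0 ≤ 48 * Q * Mr * Real.log Rm := by positivity
  have hnn2 : 0 ≤ 8 * Q * (A + 9 / 2 * (j : ℝ) * Real.log (F.L : ℝ)) := by positivity
  have hnn3 : 0 ≤ 72 * Q * x := by positivity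
  have hent1 : A + 9 * (x + (j : ℝ) / 2 * Real.log (F.L : ℝ)) ≤ p ^ 2 / (8 * Q) := by
    rw [le_div_iff₀ (by positivity)]
    have h1 : (A + 9 * (x + (j : ℝ) / 2 * Real.log (F.L : ℝ))) * (8 * Q) =
        8 * Q * (A + 9 / 2 * (j : ℝ) * Real.log (F.L : ℝ)) + 72 * Q * x := by ring
    rw [h1]
    linarith
  have hent2 : Real.log Rm ≤ p ^ 2 / (48 * Mr * Q) := by
    rw [le_div_iff₀ (by positivity)]
    have h1 : Real.log Rm * (48 * Mr * Q) = 48 * Q * Mr * Real.log Rm := by ring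
    rw [h1]
    linarith
  -- `δ ≤ exp(−p²/(8Q))` and the final bookkeeping
  have hβθ : (γ * ((F.L : ℝ)⁻¹) ^ K)⁻¹ * (θBal F.L γ b₀ p₀ (K - j) / C₁ ^ j) ^ 2 / 4 = p ^ 2 / (4 * Q) := by
    have h := beta_mul_θBal_sq_depth F hγ b₀ p₀ hjK
    rw [hp] at h
    rw [div_pow, hQ, pow_mul, ← mul_div_assoc, h]
    field_simp
    ring
  have h9 : Real.sqrt ((γ * ((F.L : ℝ)⁻¹) ^ K)⁻¹) ^ 9 = Real.exp (9 * (x + (j : ℝ) / 2 * Real.log (F.L : ℝ))) := by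
    have hsβ : 0 < Real.sqrt ((γ * ((F.L : ℝ)⁻¹) ^ K)⁻¹) := Real.sqrt_pos.mpr (one_pos.trans_le hβ1)
    rw [← hx, ← log_sqrt_beta F hγ hjK, ← Real.exp_log hsβ, ← Real.exp_nat_mul, Real.log_exp]
    norm_num
  have hδ := delta_le_exp (by rw [hA, Real.exp_log hD0]) h9 hβθ hQ0 hent1
  exact entropy_rate_bound S.card (by positivity) hRm0 hMr0 hQ0 hδ hent2

end Peierls

/-! ## §3 The EDGE stub at a fixed depth and at every bounded depth -/

section Edge

/-- **THE UNIFORM LARGE-FIELD COUNT AT A FIXED DEPTH `j`** (`c₀ = c₀(L, j, b₀)`, `C₀ = log 2`, `γ₁ = γ₁(L, j, b₀, p₀)`): for every family `F` with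
`F.L = L`, every `0 < γ ≤ γ₁` and every cut-off `K ≥ j`, `∫ exp(c₀·p(g_{K−j})²·N_j) dGibbs_K ≤ exp(log 2 · #Plaq_j)` — §2 for all subfamilies
and «joint Peierls ⇒ count moment» (p635820) with `B = 1`. [cite: Balaban1985UV3, (7) p.257 and (71) p.273] -/
theorem uniformLargeFieldCount_depth (L j : ℕ) {b₀ p₀ : ℝ} (hb₀ : 0 < b₀) (hp₀ : 1 ≤ p₀) :
    ∃ c₀ γ₁ : ℝ, 0 < c₀ ∧ 0 < γ₁ ∧ γ₁ ≤ 1 ∧ ∀ (F : T3Family) (γ : ℝ), F.L = L → 0 < γ → γ ≤ γ₁ → ∀ (K : ℕ), j ≤ K →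
      ∫ U, Real.exp (c₀ * B10.pFun b₀ p₀ (Real.sqrt (γ * ((F.L : ℝ)⁻¹) ^ (K - j))) ^ 2 *
          ∑ a : Plaq (F.P K) j, (if θBal F.L γ b₀ p₀ (K - j) ≤ GaugeGroup.dist1 (GaugeField.plaqHol
            (Averaging.iter (fun i => blockAvg (P := F.P K) (j := i) ℰp) j U) a) then (1 : ℝ) else 0))
          ∂(gibbsK F ℰp γ K) ≤
        Real.exp (Real.log 2 * (Fintype.card (Plaq (F.P K) j) : ℝ)) := by
  obtain ⟨c₀, γ₁, hc₀, hγ₁, hγ₁1, hP⟩ := averaged_jointPeierls L j hb₀ hp₀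
  refine ⟨c₀, γ₁, hc₀, hγ₁, hγ₁1, fun F γ hFL hγ hγ1 K hjK => ?_⟩
  set t : ℝ := c₀ * B10.pFun b₀ p₀ (Real.sqrt (γ * ((F.L : ℝ)⁻¹) ^ (K - j))) ^ 2 with ht
  have ht0 : 0 ≤ t := by positivity
  have hcount := integral_exp_count_le_of_jointPeierls F hγ.le K j (θBal F.L γ b₀ p₀ (K - j)) (s := t) (t := t) (B := 1)
    ht0 le_rfl zero_le_one (fun S => by rw [one_mul]; exact hP F γ hFL hγ hγ1 K hjK S)
  have h2 : (1 : ℝ) * 2 ^ Fintype.card (Plaq (F.P K) j) = Real.exp (Real.log 2 * (Fintype.card (Plaq (F.P K) j) : ℝ)) := by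
    rw [one_mul, mul_comm, Real.exp_nat_mul, Real.exp_log two_pos]
  rw [← h2]
  exact hcount

/-- **THE EDGE STUB OF CRUX `CappedCoarseStiffnessL` AT EVERY BOUNDED DEPTH, IN THE LETTERS OF THE REGISTERED STUB.**  The statement of
`stub_uniformLargeFieldCountPos` (skeleton v5, `Cruxes/CappedCoarseStiffnessL/Lines/birth.lean`) with its depth variable restricted to
`j ≤ j₀`, for EVERY `j₀`: same quantifier block (`∃ c₀ C₀ γ₁` before `F, γ, K, j`), `C₀ = log 2`, `(c₀, γ₁)` the minima over `j ≤ j₀` of the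
fixed-depth constants; the stub's hypotheses `1 ≤ j` and `2 < p₀` are not needed.  Induction on `j₀` (`integral_exp_count_mono` to shrink `c₀`).
The depths `j > j₀` — uniformly in `j`, i.e. a rate NOT decaying in the depth — are NOT covered: that is the stub's located content
([Balaban1985UV3] (71)). [cite: Balaban1985UV3, (7) p.257 and (71) p.273] -/
theorem uniformLargeFieldCount_boundedDepth :
    ∀ (L : ℕ) (b₀ p₀ : ℝ), 0 < b₀ → 2 < p₀ → ∀ (j₀ : ℕ), ∃ (c₀ C₀ γ₁ : ℝ), 0 < c₀ ∧ 0 < γ₁ ∧ γ₁ ≤ 1 ∧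
      ∀ (F : T3Family) (γ : ℝ), F.L = L → 0 < γ → γ ≤ γ₁ → ∀ (K j : ℕ), j ≤ K → j ≤ j₀ →
        ∫ U, Real.exp (c₀ * B10.pFun b₀ p₀ (Real.sqrt (γ * ((F.L : ℝ)⁻¹) ^ (K - j))) ^ 2 *
            ∑ a : Plaq (F.P K) j, (if T3UnitScaleTilt.θBal F.L γ b₀ p₀ (K - j) ≤ GaugeGroup.dist1 (GaugeField.plaqHol
              (Averaging.iter (fun i => BlockAveraging.blockAvg (P := F.P K) (j := i) T3UnitLawDensityEML.ℰp) j U) a)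
              then (1 : ℝ) else 0)) ∂(T3UnitScaleTilt.gibbsK F T3UnitLawDensityEML.ℰp γ K) ≤
          Real.exp (C₀ * (Fintype.card (Plaq (F.P K) j) : ℝ)) := by
  intro L b₀ p₀ hb₀ hp₀ j₀
  have hp₀' : 1 ≤ p₀ := by linarith
  induction j₀ with
  | zero =>
    obtain ⟨c₀, γ₁, hc₀, hγ₁, hγ₁1, h⟩ := uniformLargeFieldCount_depth L 0 hb₀ hp₀'
    refine ⟨c₀, Real.log 2, γ₁, hc₀, hγ₁, hγ₁1, fun F γ hFL hγ hγ1 K j hjK hj0 => ?_⟩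
    obtain rfl : j = 0 := Nat.le_zero.mp hj0
    exact h F γ hFL hγ hγ1 K hjK
  | succ j₀ ih =>
    obtain ⟨c₁, C₁, γ₁, hc₁, hγ₁, hγ₁1, h₁⟩ := ih
    obtain ⟨c₂, γ₂, hc₂, hγ₂, -, h₂⟩ := uniformLargeFieldCount_depth L (j₀ + 1) hb₀ hp₀'
    refine ⟨min c₁ c₂, max C₁ (Real.log 2), min γ₁ γ₂, lt_min hc₁ hc₂, lt_min hγ₁ hγ₂, (min_le_left _ _).trans hγ₁1,
      fun F γ hFL hγ hγm K j hjK hj => ?_⟩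
    have hcard : (0 : ℝ) ≤ (Fintype.card (Plaq (F.P K) j) : ℝ) := Nat.cast_nonneg _
    rcases Nat.lt_or_ge j (j₀ + 1) with hlt | hge
    · calc _ ≤ _ := integral_exp_count_mono F hγ.le b₀ p₀ K j (min_le_left c₁ c₂) hc₁.le
        _ ≤ Real.exp (C₁ * (Fintype.card (Plaq (F.P K) j) : ℝ)) :=
            h₁ F γ hFL hγ (hγm.trans (min_le_left _ _)) K j hjK (Nat.lt_succ_iff.mp hlt)
        _ ≤ _ := Real.exp_le_exp.mpr (mul_le_mul_of_nonneg_right (le_max_left _ _) hcard)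
    · obtain rfl : j = j₀ + 1 := le_antisymm hj hge
      calc _ ≤ _ := integral_exp_count_mono F hγ.le b₀ p₀ K (j₀ + 1) (min_le_right c₁ c₂) hc₂.le
        _ ≤ Real.exp (Real.log 2 * (Fintype.card (Plaq (F.P K) (j₀ + 1)) : ℝ)) :=
            h₂ F γ hFL hγ (hγm.trans (min_le_right _ _)) K hjK
        _ ≤ _ := Real.exp_le_exp.mpr (mul_le_mul_of_nonneg_right (le_max_right _ _) hcard)

/-- **THE EDGE STUB FOR EVERY BOUNDED RANGE OF CUT-OFFS.**  For every `K₀` the registered stub `stub_uniformLargeFieldCountPos` HOLDS VERBATIM on the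
cut-offs `K ≤ K₀` (all depths `1 ≤ j ≤ K`, constants uniform in the volume exponent `m` and in `γ ≤ γ₁(K₀)`): `j ≤ K ≤ K₀` is a bounded depth.  READING:
the stub's open content lies ENTIRELY in the uniformity as the cut-off `K → ∞` (the ultraviolet limit) — at every finite range of cut-offs the uniform
large-field count of the averaged plaquettes is an elementary theorem. [cite: Balaban1985UV3, (7) p.257 and (71) p.273] -/
theorem uniformLargeFieldCount_boundedCutoff :
    ∀ (L : ℕ) (b₀ p₀ : ℝ), 0 < b₀ → 2 < p₀ → ∀ (K₀ : ℕ), ∃ (c₀ C₀ γ₁ : ℝ), 0 < c₀ ∧ 0 < γ₁ ∧ γ₁ ≤ 1 ∧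
      ∀ (F : T3Family) (γ : ℝ), F.L = L → 0 < γ → γ ≤ γ₁ → ∀ (K j : ℕ), K ≤ K₀ → 1 ≤ j → j ≤ K →
        ∫ U, Real.exp (c₀ * B10.pFun b₀ p₀ (Real.sqrt (γ * ((F.L : ℝ)⁻¹) ^ (K - j))) ^ 2 *
            ∑ a : Plaq (F.P K) j, (if T3UnitScaleTilt.θBal F.L γ b₀ p₀ (K - j) ≤ GaugeGroup.dist1 (GaugeField.plaqHol
              (Averaging.iter (fun i => BlockAveraging.blockAvg (P := F.P K) (j := i) T3UnitLawDensityEML.ℰp) j U) a)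
              then (1 : ℝ) else 0)) ∂(T3UnitScaleTilt.gibbsK F T3UnitLawDensityEML.ℰp γ K) ≤
          Real.exp (C₀ * (Fintype.card (Plaq (F.P K) j) : ℝ)) := by
  intro L b₀ p₀ hb₀ hp₀ K₀
  obtain ⟨c₀, C₀, γ₁, hc₀, hγ₁, hγ₁1, h⟩ := uniformLargeFieldCount_boundedDepth L b₀ p₀ hb₀ hp₀ K₀
  exact ⟨c₀, C₀, γ₁, hc₀, hγ₁, hγ₁1, fun F γ hFL hγ hγ1 K j hK _ hjK => h F γ hFL hγ hγ1 K j hjK (hjK.trans hK)⟩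

end Edge

end Summit.QuantumFields.YangMills.Theorems.CoarseStiffnessTailEdgeBoundedDepth

end
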